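import Summits.ABC.IUTFork.ForkPacketReal
import Literature.IUT.LogVolume.TensorPacketOrbitVolume
import HarnessLib

/-!
# The Θ-hull at one REAL summand is the hull of `p^m · log_p(R_I^×)` — the LOWER half of Step (v)
# (sequel to skeleton XXVI `ForkPacketReal`; Dupuy–Hilado §4.9–4.12; [IUTchIV] Prop. 1.2/1.4)

Record-only companion (abc-iut cell, prover seat abc-iut-w5-d180) to the skeleton seat's XXVI
(`Summits/ABC/IUTFork/ForkPacketReal.lean`, p417081) and to `HOME/skel/FORK-REAL-MODEL.md` §4: "MISSING FOR A
TWO-SIDED KERNEL STATEMENT: the hull LOWER bound `hull(⋃_{g∈G₂} g·(ι(t)·O)) ⊇ p^m·hull(𝓘-lattice)` … GRANTED THAT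
(standard p-adic lattice algebra, not in the tree)". That algebra is now in the tree
(`Literature.IUT.LogVolume.LatticeAutOrbits` / `TensorPacketOrbitSpan` / `TensorPacketOrbitContent` /
`TensorPacketOrbitVolume`, p418876 / p419169 / p419745 / successor), and HERE it is read at XXVI's objects: for
the summand `v⃗ = e` of c312-3's `realPrimePacket p 𝔽`, its (Ind2) group `G₂ = Aut_{ℚ_p}(V : log_p(R_I^×))`, its
hull, and SHARP (Ind3)-data `B` around theta values `t` exactly as in XXVI's `thetaHull_bound` (`B_σ ⊆
t_{v_{σ(j)}}·O_{v⃗∘σ}`, `t_{v_j}·O_{v⃗} ⊆ B_1`):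

* `orbit_eq_iUnion_smul`: XXVI's `orbit e B = ⋃_{g ∈ G₂} g·M` with `M := ⋃_σ perm_σ(B_{v⃗∘σ})` (the (Ind1)-union);
* `isPsiBounded_indOneUnion`, `exists_ne_zero_mem_indOneUnion`: `M` is bounded and `∌` only `0` (it contains
  `ι_j(t_{v_j}) ≠ 0`);
* **`thetaHull_eq_packetHull_zpow_logPacket`**: there is a unique-by-content `m ∈ ℤ` with
  `M ⊆ p^m·log_p(R_I^×)`, `M ⊄ p^{m+1}·log_p(R_I^×)` and

    `thetaHull e B = hull(p^m · log_p(R_I^×))`,   `log μ̄(thetaHull e B) = −m·log p + log μ̄(hull(log_p(R_I^×)))`,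

  the Θ-hull being admissible. So with the FULL (Ind2) group of the real packet the Θ-hull at a summand — hence
  its log-volume — depends on the sharp (Ind3)-data ONLY through the content `m` of their (Ind1)-union w.r.t. the
  log-shell lattice; XXVI's upper bound `thetaHull_bound` ([IUTchIV] Step (v)) is matched by this exact formula,
  and the remaining slack «Budget_actual vs Budget» of FORK-REAL-MODEL §4 is the bookkeeping of `m` against
  `ord(t)` through the [IUTchIV] Prop. 1.2 (i) sandwich `⊗α_i·R_I ⊆ log_p(R_I^×) ⊆ ⊗h_i·(R_I)^∼`
  (`TensorPacketShell`), not done here.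

HONEST SCOPE: summand level (= the `(j,p)`-packet when `𝕍` has one place over `p`), sharp (Ind3), nothing about
the GLOBAL `Cor312.Setting.Statement`; (Ind2)/hull/orbit are the tree's typings of disputed-corpus constructions
[claim: Mochizuki2012, status: disputed]; the lattice algebra is classical [cite: WeilBNT1967, Ch. II §2, Th. 1–2]
[cite: DupuyHilado2025, §4.7, §4.9, §4.12]. typed ≠ proved; no side taken on [IUTchIII] Cor. 3.12.
PROOF-ONLY file: no definitions, no named `Prop` facts.
-/

noncomputable section

open Set Literature.IUT.LogVolume
open scoped Pointwise

namespace Summit.ABC.IUTFork.PacketReal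

variable {F : Type} [Field F] [NumberField F]
variable (p : ℕ) [Fact p.Prime] (𝔽 : LocalFields F p)

/-! ## The orbit is the (Ind2)-orbit of the (Ind1)-union -/

/-- XXVI's local orbit is the (Ind2)-orbit of the (Ind1)-union `M = ⋃_σ perm_σ(B_{v⃗∘σ})` (`g·` distributes over
unions). [cite: DupuyHilado2025, §4.7, §4.9, §4.11] -/
theorem orbit_eq_iUnion_smul {j : ℕ} (e : Fin (j + 1) → placesOver F p) (B : (realPrimePacket p 𝔽).Region) :
    orbit p 𝔽 e B = ⋃ g : (realPrimePacket p 𝔽).G₂ j e,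
      g • ⋃ σ : Equiv.Perm (Fin (j + 1)), (realPrimePacket p 𝔽).perm σ e '' B j (e ∘ σ) := by
  simp only [orbit, Set.smul_set_iUnion]

/-- **The (Ind1)-union of sharp (Ind3)-data is bounded** (each `perm_σ(B_σ) ⊆ perm_σ(t·O_{v⃗∘σ}) =
ι_{σ(j)}(t)·(R_I)^∼`, a bounded translate). [cite: DupuyHilado2025, §4.7, §4.12] -/
theorem isPsiBounded_indOneUnion {j : ℕ} (e : Fin (j + 1) → placesOver F p)
    (t : ∀ v : placesOver F p, (𝔽.k v)ˣ) (B : (realPrimePacket p 𝔽).Region)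
    (hB : ∀ σ : Equiv.Perm (Fin (j + 1)), B j (e ∘ σ) ⊆ pilotRegion p 𝔽 (e ∘ σ) (t (e (σ (Fin.last j))))) :
    IsPsiBounded p (fun i => 𝔽.k (e i))
      (⋃ σ : Equiv.Perm (Fin (j + 1)), (realPrimePacket p 𝔽).perm σ e '' B j (e ∘ σ)) := by
  refine isPsiBounded_iUnion p (fun i => 𝔽.k (e i)) fun σ => ?_
  have h1 : (realPrimePacket p 𝔽).perm σ e '' B j (e ∘ σ) ⊆
      iota p (fun i => 𝔽.k (e i)) (σ (Fin.last j)) (t (e (σ (Fin.last j))) : _) •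
        (normalizedPacket p (fun i => 𝔽.k (e i)) : Set (PacketAlgebra p (fun i => 𝔽.k (e i)))) := by
    rw [← realPrimePacket_perm_image_bare p 𝔽 σ e (t (e (σ (Fin.last j))))]
    exact Set.image_mono (hB σ)
  exact IsPsiBounded.subset p (fun i => 𝔽.k (e i)) (isPsiBounded_smul_normalizedPacket p (fun i => 𝔽.k (e i)) _) h1

/-- **The (Ind1)-union contains a nonzero vector**, namely `ι_j(t_{v_j}) = ι_j(t_{v_j})·1 ∈ t_{v_j}·O_{v⃗} ⊆ B_1`.
[cite: DupuyHilado2025, §3.7, §4.11] -/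
theorem exists_ne_zero_mem_indOneUnion {j : ℕ} (e : Fin (j + 1) → placesOver F p)
    (t : ∀ v : placesOver F p, (𝔽.k v)ˣ) (B : (realPrimePacket p 𝔽).Region)
    (hB1 : pilotRegion p 𝔽 e (t (e (Fin.last j))) ⊆ B j e) :
    ∃ x : PacketAlgebra p (fun i => 𝔽.k (e i)),
      x ∈ (⋃ σ : Equiv.Perm (Fin (j + 1)), (realPrimePacket p 𝔽).perm σ e '' B j (e ∘ σ)) ∧ x ≠ 0 := by
  refine ⟨iota p (fun i => 𝔽.k (e i)) (Fin.last j) (t (e (Fin.last j)) : 𝔽.k (e (Fin.last j))), ?_, ?_⟩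
  · refine Set.mem_iUnion.mpr ⟨1, ?_⟩
    have hx : iota p (fun i => 𝔽.k (e i)) (Fin.last j) (t (e (Fin.last j)) : 𝔽.k (e (Fin.last j))) ∈ B j e := by
      refine hB1 ⟨(1 : PacketAlgebra p (fun i => 𝔽.k (e i))),
        Subring.one_mem (normalizedPacket p (fun i => 𝔽.k (e i))), ?_⟩
      change iota p (fun i => 𝔽.k (e i)) (Fin.last j) (t (e (Fin.last j)) : 𝔽.k (e (Fin.last j))) * 1 = _
      rw [mul_one]
    exact ⟨_, hx, (realPrimePacket p 𝔽).perm_one e _⟩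
  · exact (map_ne_zero (iota p (fun i => 𝔽.k (e i)) (Fin.last j))).mpr (t (e (Fin.last j))).ne_zero

/-! ## The Θ-hull is the hull of `p^m · log_p(R_I^×)` -/

/-- **The Θ-hull at `v⃗` is `hull(p^m·log_p(R_I^×))` for the content `m` of the (Ind1)-union, with
`log μ̄ = −m·log p + log μ̄(hull(log_p(R_I^×)))`** — for every sharp (Ind3)-datum around theta values `t`
(hypotheses `hB`, `hB1` of XXVI's `thetaHull_bound`). The LOWER half of Step (v): XXVI bounds this volume above by
`log‖t_{v_{i₀}}‖ + {d_I + 1}·log(p) + Σ(3 + log e_i)`; here it is an exact affine function of the one integer `m`.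
[cite: DupuyHilado2025, §4.9, §4.12] [cite: WeilBNT1967, Ch. II §2, Th. 2] -/
theorem thetaHull_eq_packetHull_zpow_logPacket {j : ℕ} (e : Fin (j + 1) → placesOver F p)
    (t : ∀ v : placesOver F p, (𝔽.k v)ˣ) (B : (realPrimePacket p 𝔽).Region)
    (hB : ∀ σ : Equiv.Perm (Fin (j + 1)), B j (e ∘ σ) ⊆ pilotRegion p 𝔽 (e ∘ σ) (t (e (σ (Fin.last j)))))
    (hB1 : pilotRegion p 𝔽 e (t (e (Fin.last j))) ⊆ B j e) :
    ∃ m : ℤ,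
      (⋃ σ : Equiv.Perm (Fin (j + 1)), (realPrimePacket p 𝔽).perm σ e '' B j (e ∘ σ)) ⊆
          ((p : ℚ_[p]) ^ m) • (logPacket p (fun i => 𝔽.k (e i)) : Set (PacketAlgebra p (fun i => 𝔽.k (e i)))) ∧
      ¬ (⋃ σ : Equiv.Perm (Fin (j + 1)), (realPrimePacket p 𝔽).perm σ e '' B j (e ∘ σ)) ⊆
          ((p : ℚ_[p]) ^ (m + 1)) •
            (logPacket p (fun i => 𝔽.k (e i)) : Set (PacketAlgebra p (fun i => 𝔽.k (e i)))) ∧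
      thetaHull p 𝔽 e B = packetHull p (fun i => 𝔽.k (e i))
          (((p : ℚ_[p]) ^ m) • (logPacket p (fun i => 𝔽.k (e i)) : Set (PacketAlgebra p (fun i => 𝔽.k (e i))))) ∧
      (realPrimePacket p 𝔽).adm (thetaHull p 𝔽 e B) ∧
      (realPrimePacket p 𝔽).logμ (thetaHull p 𝔽 e B) =
        -(m * Real.log p) + packetLogμ p (fun i => 𝔽.k (e i))
          (packetHull p (fun i => 𝔽.k (e i)) (logPacket p (fun i => 𝔽.k (e i)) : Set _)) := by
  haveI : Nonempty (Fin (j + 1)) := ⟨0⟩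
  have hMb := isPsiBounded_indOneUnion p 𝔽 e t B hB
  have hM0 := exists_ne_zero_mem_indOneUnion p 𝔽 e t B hB1
  obtain ⟨m, hm, hm1⟩ := exists_content p (fun i => 𝔽.k (e i)) hMb hM0
  obtain ⟨x, hxM, hx⟩ := Set.not_subset.mp hm1
  have hhull : thetaHull p 𝔽 e B = packetHull p (fun i => 𝔽.k (e i))
      (((p : ℚ_[p]) ^ m) • (logPacket p (fun i => 𝔽.k (e i)) : Set (PacketAlgebra p (fun i => 𝔽.k (e i))))) := by
    change packetHull p (fun i => 𝔽.k (e i)) (orbit p 𝔽 e B) = _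
    rw [orbit_eq_iUnion_smul]
    exact packetHull_orbit_eq_zpow p (fun i => 𝔽.k (e i)) hxM hx hm
  refine ⟨m, hm, hm1, hhull, ?_, ?_⟩
  · rw [hhull]
    exact packetAdm_packetHull_zpow_smul_logPacket p (fun i => 𝔽.k (e i)) m
  · rw [hhull]
    exact packetLogμ_packetHull_zpow_smul_logPacket p (fun i => 𝔽.k (e i)) m

/-- **Sharp (Ind3)-data with (Ind1)-unions of the same content have the SAME Θ-hull** (the shape of the data is
invisible to the hull once the full (Ind2) group acts). [cite: DupuyHilado2025, §4.9, §4.12] -/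
theorem thetaHull_eq_of_content_eq {j : ℕ} (e : Fin (j + 1) → placesOver F p)
    (B B' : (realPrimePacket p 𝔽).Region) {m : ℤ} {x x' : PacketAlgebra p (fun i => 𝔽.k (e i))}
    (hx : x ∈ ⋃ σ : Equiv.Perm (Fin (j + 1)), (realPrimePacket p 𝔽).perm σ e '' B j (e ∘ σ))
    (hx1 : x ∉ ((p : ℚ_[p]) ^ (m + 1)) •
      (logPacket p (fun i => 𝔽.k (e i)) : Set (PacketAlgebra p (fun i => 𝔽.k (e i)))))
    (hM : (⋃ σ : Equiv.Perm (Fin (j + 1)), (realPrimePacket p 𝔽).perm σ e '' B j (e ∘ σ)) ⊆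
      ((p : ℚ_[p]) ^ m) • (logPacket p (fun i => 𝔽.k (e i)) : Set (PacketAlgebra p (fun i => 𝔽.k (e i)))))
    (hx' : x' ∈ ⋃ σ : Equiv.Perm (Fin (j + 1)), (realPrimePacket p 𝔽).perm σ e '' B' j (e ∘ σ))
    (hx1' : x' ∉ ((p : ℚ_[p]) ^ (m + 1)) •
      (logPacket p (fun i => 𝔽.k (e i)) : Set (PacketAlgebra p (fun i => 𝔽.k (e i)))))
    (hM' : (⋃ σ : Equiv.Perm (Fin (j + 1)), (realPrimePacket p 𝔽).perm σ e '' B' j (e ∘ σ)) ⊆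
      ((p : ℚ_[p]) ^ m) • (logPacket p (fun i => 𝔽.k (e i)) : Set (PacketAlgebra p (fun i => 𝔽.k (e i))))) :
    thetaHull p 𝔽 e B = thetaHull p 𝔽 e B' := by
  change packetHull p (fun i => 𝔽.k (e i)) (orbit p 𝔽 e B) = packetHull p (fun i => 𝔽.k (e i)) (orbit p 𝔽 e B')
  rw [orbit_eq_iUnion_smul, orbit_eq_iUnion_smul]
  exact packetHull_orbit_eq_of_content_eq p (fun i => 𝔽.k (e i)) hx hx1 hM hx' hx1' hM'

end Summit.ABC.IUTFork.PacketReal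

end
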